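import Literature.MathematicalPhysics.QuantumLattice.SectorSymbolMasterBox
import HarnessLib

/-!
# The master symbol at scale zero: affine rescaled dispersion and the shear antisymmetry
(Benfatto–Giuliani–Mastropietro 2006, Lemma 2.2a: the oddness at `s = 0`)

Topic `Literature/MathematicalPhysics/QuantumLattice`; continues `SectorSymbolMasterBox.lean`.
At `s = 0` the master symbol `Φ̂(θ₀, t; 0)` is the `h → -∞` limit of the rescaled sector symbols.
BGM prove `|g_ω^{(h)}(0)| ≤ Cγ^{(5/2)h}` by rewriting `g(0)` in the variables `(k₀, e)`,
`e = ε - μ`, where the leading term `∫ dk₀ de f̃(√(k₀² + e²))/(-ik₀ + e)` "is zero by oddity"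
((2.56c)–(2.56e)). In the master-function language this is the following structure at `s = 0`, PROVED here:

* `fderiv_sqDispersion_apply` — `Dε(k)v = 2 sin k₁ v₁ + 2 sin k₂ v₂`; `grad_fermi_dot_fermiNormal` —
  `∇ε(p_F(θ))·n(θ) = 2 c(θ) s'(θ) =: normalGrad μ θ > 0`;
* `rescaledDispersion_zero_sub` — **`Ẽ(θ₀, t₁, t₂; 0) - Ẽ(θ₀, 0, t₂; 0) = normalGrad(θ₀) t₁`**:
  at `s = 0` the rescaled dispersion is AFFINE in the normal variable `t₁` (from the strict
  differentiability of `ε` at `p_F`: `ε(P_s + s²t₁n) - ε(P_s) = s²t₁ ∇ε(p_F)·n + o(s²)`);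
* `rescaledAngle_zero_eq` — `Ã(θ₀, t₁, t₂; 0) = Ã(θ₀, 0, t₂; 0)` does not depend on `t₁`;
* **`masterSymbol_zero_shear`** — with the shift `δ(θ₀, t₂) = 2Ẽ(θ₀, 0, t₂; 0)/normalGrad(θ₀)`,
  `Φ̂(θ₀, (-t₀, -t₁ - δ, t₂); 0) = -Φ̂(θ₀, (t₀, t₁, t₂); 0)`:
  the measure-preserving involution `(t₀, t₁) ↦ (-t₀, -t₁ - δ)` flips `(k₀, e) ↦ (-k₀, -e)`.

Everything is PROVED; the definitions are `normalGrad` and `zeroShift`.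

## Sources

* G. Benfatto, A. Giuliani, V. Mastropietro, Ann. Henri Poincaré 7 (2006) 809–898, §2.5 Lemma 2.2a
  (2.56a)–(2.56e) (arXiv:cond-mat/0507686 p. 11). [BenfattoGiulianiMastropietro2006]
-/

noncomputable section

open Real Set Complex Function Metric Filter Asymptotics
open scoped Topology ComplexConjugate
open Literature.Analysis.Calculus Literature.Analysis.SpecialFunctions

namespace Literature.MathematicalPhysics.QuantumLattice

/-! ### The gradient of the dispersion and its normal component -/

/-- `ε` is `C¹` (all levels). [folklore] -/
theorem contDiff_one_sqDispersion : ContDiff ℝ 1 sqDispersion := contDiff_sqDispersion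

/-- **`Dε(k)v = 2 sin k₁ v₁ + 2 sin k₂ v₂`.** [folklore] -/
theorem fderiv_sqDispersion_apply (k v : Fin 2 → ℝ) :
    fderiv ℝ sqDispersion k v = 2 * Real.sin (k 0) * v 0 + 2 * Real.sin (k 1) * v 1 := by
  have hd : DifferentiableAt ℝ sqDispersion k := (contDiff_one_sqDispersion.differentiable one_ne_zero).differentiableAt
  have hline : HasDerivAt (fun r : ℝ => k + r • v) v 0 := by
    simpa using ((hasDerivAt_id (0 : ℝ)).smul_const v).const_add k
  have h1 : HasDerivAt (fun r : ℝ => sqDispersion (k + r • v)) (fderiv ℝ sqDispersion k v) 0 := by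
    have hd' : DifferentiableAt ℝ sqDispersion (k + (0 : ℝ) • v) := by simpa using hd
    have := hd'.hasFDerivAt.comp_hasDerivAt (0 : ℝ) hline
    simpa [Function.comp_def] using this
  -- the same derivative computed in coordinates
  have hc0 : HasDerivAt (fun r : ℝ => Real.cos (k 0 + r * v 0)) (-Real.sin (k 0) * v 0) 0 := by
    have := (Real.hasDerivAt_cos (k 0 + 0 * v 0)).comp (0 : ℝ) (((hasDerivAt_id (0 : ℝ)).mul_const (v 0)).const_add (k 0))
    simpa [Function.comp_def] using this
  have hc1 : HasDerivAt (fun r : ℝ => Real.cos (k 1 + r * v 1)) (-Real.sin (k 1) * v 1) 0 := by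
    have := (Real.hasDerivAt_cos (k 1 + 0 * v 1)).comp (0 : ℝ) (((hasDerivAt_id (0 : ℝ)).mul_const (v 1)).const_add (k 1))
    simpa [Function.comp_def] using this
  have h2 : HasDerivAt (fun r : ℝ => sqDispersion (k + r • v)) (-2 * (-Real.sin (k 0) * v 0 + -Real.sin (k 1) * v 1)) 0 := by
    have h := (hc0.add hc1).const_mul (-2 : ℝ)
    refine h.congr_of_eventuallyEq (Eventually.of_forall fun r => ?_)
    simp [sqDispersion]
  rw [h1.unique h2]; ring

/-- The normal component of the gradient on the Fermi curve, `normalGrad = 2 c(θ) s'(θ)`. [cite: BenfattoGiulianiMastropietro2003, §7.1 (A1.17)] -/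
def normalGrad (μ θ : ℝ) : ℝ := 2 * normalCoeff μ θ * fermiSpeed μ θ

section Grad

variable {μ : ℝ} (hμ₁ : -4 < μ) (hμ₂ : μ < -2 - Real.sqrt 2)
include hμ₁ hμ₂

/-- `normalGrad > 0`. [folklore] -/
theorem normalGrad_pos (θ : ℝ) : 0 < normalGrad μ θ :=
  mul_pos (mul_pos two_pos (normalCoeff_pos hμ₁ hμ₂ θ)) (fermiSpeed_pos hμ₁ hμ₂ θ)

/-- **`∇ε(p_F(θ))·n(θ) = 2 c(θ) s'(θ)`** (`∇ε = a n` with `a > 0`, BGM 2003 (A1.17)). [cite: BenfattoGiulianiMastropietro2003, §7.1 (A1.17)] -/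
theorem grad_fermi_dot_fermiNormal (θ : ℝ) :
    2 * Real.sin (fermiX μ θ) * fermiNormal μ θ 0 + 2 * Real.sin (fermiY μ θ) * fermiNormal μ θ 1 = normalGrad μ θ := by
  have hs := fermiSpeed_pos hμ₁ hμ₂ θ
  have hsq := fermiSpeed_sq μ θ
  rw [sin_fermiX_eq hμ₁ hμ₂, sin_fermiY_eq hμ₁ hμ₂, normalGrad]
  simp only [fermiNormal, Pi.smul_apply, smul_eq_mul, Matrix.cons_val_zero, Matrix.cons_val_one]
  rw [show 2 * (normalCoeff μ θ * fermiVY μ θ) * ((fermiSpeed μ θ)⁻¹ * fermiVY μ θ) +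
      2 * -(normalCoeff μ θ * fermiVX μ θ) * ((fermiSpeed μ θ)⁻¹ * -fermiVX μ θ) =
      2 * normalCoeff μ θ * (fermiSpeed μ θ)⁻¹ * (fermiVX μ θ ^ 2 + fermiVY μ θ ^ 2) by ring, ← hsq]
  field_simp

end Grad

/-! ### The rescaled quantities at `s = 0` as limits -/

section Zero

variable {μ : ℝ} (hμ₁ : -4 < μ) (hμ₂ : μ < -2 - Real.sqrt 2)
include hμ₁ hμ₂

/-- `Ẽ(x, 0) = lim_{s→0, s≠0} (ε(k(x,s)) - μ)/s²`. [folklore] -/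
theorem tendsto_div_sq_rescaledDispersion (x : ℝ × ℝ × ℝ) :
    Tendsto (fun s : ℝ => sectorEpsFun μ (x, s) / s ^ 2) (𝓝[≠] 0) (𝓝 (rescaledDispersion μ (x, 0))) := by
  have hcont : Continuous fun s : ℝ => rescaledDispersion μ (x, s) :=
    (contDiff_rescaledDispersion hμ₁ hμ₂ (μ := μ)).continuous.comp (by fun_prop)
  have hlim : Tendsto (fun s : ℝ => rescaledDispersion μ (x, s)) (𝓝[≠] 0) (𝓝 (rescaledDispersion μ (x, 0))) :=
    (hcont.tendsto 0).mono_left nhdsWithin_le_nhds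
  refine hlim.congr' ?_
  filter_upwards [self_mem_nhdsWithin] with s hs
  rw [sectorEpsFun_eq_sq_mul_rescaledDispersion hμ₁ hμ₂ x s, mul_div_cancel_left₀ _ (pow_ne_zero 2 hs)]

/-- `Ã(x, 0) = lim_{s→0, s≠0} angFun(x,s)/s`. [folklore] -/
theorem tendsto_div_rescaledAngle (x : ℝ × ℝ × ℝ) :
    Tendsto (fun s : ℝ => sectorAngFun μ (x, s) / s) (𝓝[≠] 0) (𝓝 (rescaledAngle μ (x, 0))) := by
  have hcont : Continuous fun s : ℝ => rescaledAngle μ (x, s) :=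
    (contDiff_rescaledAngle hμ₁ hμ₂ (μ := μ)).continuous.comp (by fun_prop)
  have hlim : Tendsto (fun s : ℝ => rescaledAngle μ (x, s)) (𝓝[≠] 0) (𝓝 (rescaledAngle μ (x, 0))) :=
    (hcont.tendsto 0).mono_left nhdsWithin_le_nhds
  refine hlim.congr' ?_
  filter_upwards [self_mem_nhdsWithin] with s hs
  rw [sectorAngFun_eq_mul_rescaledAngle hμ₁ hμ₂ x s, mul_div_cancel_left₀ _ hs]

omit hμ₁ hμ₂ in
/-- The chart points at `t₁` and at `t₁ = 0` differ by `s² t₁ n(θ₀)`. [folklore] -/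
theorem sectorChartPoint_sub (μ θ₀ t₁ t₂ s : ℝ) :
    sectorChartPoint μ (θ₀, t₁, t₂) s - sectorChartPoint μ (θ₀, 0, t₂) s = (s ^ 2 * t₁) • fermiNormal μ θ₀ := by
  ext i
  fin_cases i
  · simp only [Fin.zero_eta, Fin.isValue, Pi.sub_apply, Pi.smul_apply, smul_eq_mul, sectorChartPoint_apply_zero]; ring
  · simp only [Fin.mk_one, Fin.isValue, Pi.sub_apply, Pi.smul_apply, smul_eq_mul, sectorChartPoint_apply_one]; ring

omit hμ₁ hμ₂ in
/-- Both chart points tend to `p_F(θ₀)` as `s → 0`. [folklore] -/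
theorem tendsto_sectorChartPoint (μ θ₀ t₁ t₂ : ℝ) :
    Tendsto (fun s : ℝ => sectorChartPoint μ (θ₀, t₁, t₂) s) (𝓝 0) (𝓝 ![fermiX μ θ₀, fermiY μ θ₀]) := by
  have hc : Continuous fun s : ℝ => sectorChartPoint μ (θ₀, t₁, t₂) s := by
    refine continuous_pi fun i => ?_
    fin_cases i
    · simp only [Fin.zero_eta, Fin.isValue, sectorChartPoint_apply_zero]; fun_prop
    · simp only [Fin.mk_one, Fin.isValue, sectorChartPoint_apply_one]; fun_prop
  have := hc.tendsto 0
  rwa [sectorChartPoint_zero] at this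

/-- **At `s = 0` the rescaled dispersion is affine in `t₁`**:
`Ẽ(θ₀, t₁, t₂; 0) - Ẽ(θ₀, 0, t₂; 0) = normalGrad(θ₀) t₁`. [cite: BenfattoGiulianiMastropietro2006, §2.5 Lemma 2.2a] -/
theorem rescaledDispersion_zero_sub (θ₀ t₁ t₂ : ℝ) :
    rescaledDispersion μ ((θ₀, t₁, t₂), 0) - rescaledDispersion μ ((θ₀, 0, t₂), 0) = normalGrad μ θ₀ * t₁ := by
  set pF : Fin 2 → ℝ := ![fermiX μ θ₀, fermiY μ θ₀] with hpF
  set L := fderiv ℝ sqDispersion pF with hL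
  have hstrict : HasStrictFDerivAt sqDispersion L pF :=
    (contDiff_one_sqDispersion.contDiffAt (x := pF)).hasStrictFDerivAt one_ne_zero
  have hLn : L (fermiNormal μ θ₀) = normalGrad μ θ₀ := by
    rw [← grad_fermi_dot_fermiNormal hμ₁ hμ₂ θ₀, hL, fderiv_sqDispersion_apply]
    simp [hpF]
  set y : ℝ → Fin 2 → ℝ := fun s => sectorChartPoint μ (θ₀, t₁, t₂) s with hy
  set z : ℝ → Fin 2 → ℝ := fun s => sectorChartPoint μ (θ₀, 0, t₂) s with hz
  have hyz : ∀ s, y s - z s = (s ^ 2 * t₁) • fermiNormal μ θ₀ := fun s => sectorChartPoint_sub μ θ₀ t₁ t₂ s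
  have hpair : Tendsto (fun s => (y s, z s)) (𝓝 0) (𝓝 (pF, pF)) :=
    (tendsto_sectorChartPoint μ θ₀ t₁ t₂).prodMk_nhds (tendsto_sectorChartPoint μ θ₀ 0 t₂)
  -- the remainder `R(s) = ε(y) - ε(z) - L(y - z)` is `o(s²)`
  have ho := hstrict.isLittleO.comp_tendsto hpair
  simp only [Function.comp_def] at ho
  have hO : (fun s => y s - z s) =O[𝓝 0] fun s : ℝ => s ^ 2 := by
    refine IsBigO.of_bound (|t₁| * ‖fermiNormal μ θ₀‖) (Eventually.of_forall fun s => ?_)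
    rw [hyz, norm_smul, Real.norm_eq_abs, abs_mul, abs_pow, Real.norm_eq_abs, abs_pow]
    exact le_of_eq (by ring)
  have hRlim : Tendsto (fun s => (sqDispersion (y s) - sqDispersion (z s) - L (y s - z s)) / s ^ 2) (𝓝[≠] 0) (𝓝 0) :=
    ((ho.trans_isBigO hO).tendsto_div_nhds_zero).mono_left nhdsWithin_le_nhds
  -- the difference quotient is `normalGrad t₁ + R(s)/s²`
  have hD : Tendsto (fun s : ℝ => sectorEpsFun μ ((θ₀, t₁, t₂), s) / s ^ 2 - sectorEpsFun μ ((θ₀, 0, t₂), s) / s ^ 2)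
      (𝓝[≠] 0) (𝓝 (normalGrad μ θ₀ * t₁)) := by
    have h1 : Tendsto (fun s => normalGrad μ θ₀ * t₁ + (sqDispersion (y s) - sqDispersion (z s) - L (y s - z s)) / s ^ 2)
        (𝓝[≠] 0) (𝓝 (normalGrad μ θ₀ * t₁)) := by
      simpa using tendsto_const_nhds.add hRlim
    refine h1.congr' ?_
    filter_upwards [self_mem_nhdsWithin] with s hs
    have hs' : s ≠ 0 := hs
    have hLyz : L (y s - z s) = s ^ 2 * t₁ * normalGrad μ θ₀ := by rw [hyz, map_smul, hLn, smul_eq_mul]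
    rw [hLyz, ← sub_div]
    have hnum : sectorEpsFun μ ((θ₀, t₁, t₂), s) - sectorEpsFun μ ((θ₀, 0, t₂), s) = sqDispersion (y s) - sqDispersion (z s) := by
      simp only [sectorEpsFun, hy, hz]; ring
    rw [hnum]
    field_simp
    ring
  have hD' : Tendsto (fun s : ℝ => sectorEpsFun μ ((θ₀, t₁, t₂), s) / s ^ 2 - sectorEpsFun μ ((θ₀, 0, t₂), s) / s ^ 2)
      (𝓝[≠] 0) (𝓝 (rescaledDispersion μ ((θ₀, t₁, t₂), 0) - rescaledDispersion μ ((θ₀, 0, t₂), 0))) :=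
    (tendsto_div_sq_rescaledDispersion hμ₁ hμ₂ _).sub (tendsto_div_sq_rescaledDispersion hμ₁ hμ₂ _)
  exact tendsto_nhds_unique hD' hD

omit hμ₁ hμ₂ in
/-- `momToComplex` is additive and homogeneous. [folklore] -/
theorem momToComplex_sub_smul (a b : Fin 2 → ℝ) (c : ℝ) (v : Fin 2 → ℝ) (h : a - b = c • v) :
    momToComplex a - momToComplex b = (c : ℂ) * momToComplex v := by
  have h0 : a 0 - b 0 = c * v 0 := by have := congr_fun h 0; simpa using this
  have h1 : a 1 - b 1 = c * v 1 := by have := congr_fun h 1; simpa using this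
  apply Complex.ext <;> simp [h0, h1]

/-- **At `s = 0` the rescaled angle does not depend on `t₁`**: `Ã(θ₀, t₁, t₂; 0) = Ã(θ₀, 0, t₂; 0)`
(the two `u`'s differ by `O(s²)` and `truncArg` is strictly differentiable). [cite: BenfattoGiulianiMastropietro2006, §2.5 Lemma 2.2a] -/
theorem rescaledAngle_zero_eq (θ₀ t₁ t₂ : ℝ) :
    rescaledAngle μ ((θ₀, t₁, t₂), 0) = rescaledAngle μ ((θ₀, 0, t₂), 0) := by
  set T : ℂ → ℝ := truncArg (truncRadius μ) (Real.cos (7 * π / 8)) (Real.cos (15 * π / 16)) with hT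
  have hTs : ContDiff ℝ 1 T := contDiff_truncArg (truncRadius_pos hμ₁) cos_fifteen_lt_cos_seven neg_one_lt_cos_fifteen
  set u₁ : ℝ → ℂ := fun s => sectorUFun μ (θ₀, t₁, t₂) s with hu₁
  set u₀ : ℝ → ℂ := fun s => sectorUFun μ (θ₀, 0, t₂) s with hu₀
  set w : ℂ := (t₁ : ℂ) * momToComplex (fermiNormal μ θ₀) * Complex.exp (-((θ₀ : ℝ) * I)) with hw
  have hdiff : ∀ s, u₁ s - u₀ s = ((s ^ 2 : ℝ) : ℂ) * w := fun s => by
    simp only [hu₁, hu₀, sectorUFun, hw]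
    rw [← sub_mul, momToComplex_sub_smul _ _ _ _ (sectorChartPoint_sub μ θ₀ t₁ t₂ s)]
    push_cast; ring
  have hstar : u₀ 0 = (fermiRadius μ θ₀ : ℂ) := sectorUFun_zero (θ₀, 0, t₂)
  have hstrict := (hTs.contDiffAt (x := u₀ 0)).hasStrictFDerivAt one_ne_zero
  set L := fderiv ℝ T (u₀ 0) with hL
  have hcu : Continuous (uncurry (sectorUFun μ)) := (contDiff_uncurry_sectorUFun hμ₁ hμ₂ (μ := μ)).continuous
  have hc₁ : Continuous u₁ := by
    have h := hcu.comp (Continuous.prodMk_right ((θ₀, t₁, t₂) : ℝ × ℝ × ℝ) (Y := ℝ))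
    simp only [Function.comp_def, uncurry_apply_pair] at h
    exact h
  have hc₀ : Continuous u₀ := by
    have h := hcu.comp (Continuous.prodMk_right ((θ₀, (0 : ℝ), t₂) : ℝ × ℝ × ℝ) (Y := ℝ))
    simp only [Function.comp_def, uncurry_apply_pair] at h
    exact h
  have h10 : u₁ 0 = u₀ 0 := by rw [hu₁, hstar]; exact sectorUFun_zero (θ₀, t₁, t₂)
  have hpair : Tendsto (fun s => (u₁ s, u₀ s)) (𝓝 0) (𝓝 (u₀ 0, u₀ 0)) := by
    have := (hc₁.tendsto 0).prodMk_nhds (hc₀.tendsto 0)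
    rwa [h10] at this
  have ho := hstrict.isLittleO.comp_tendsto hpair
  simp only [Function.comp_def] at ho
  have hO : (fun s => u₁ s - u₀ s) =O[𝓝 0] fun s : ℝ => s ^ 2 := by
    refine IsBigO.of_bound ‖w‖ (Eventually.of_forall fun s => ?_)
    rw [hdiff, norm_mul, Complex.norm_real, Real.norm_eq_abs]
    exact le_of_eq (mul_comm _ _)
  have hRlim : Tendsto (fun s => (T (u₁ s) - T (u₀ s) - L (u₁ s - u₀ s)) / s ^ 2) (𝓝[≠] 0) (𝓝 0) :=
    ((ho.trans_isBigO hO).tendsto_div_nhds_zero).mono_left nhdsWithin_le_nhds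
  -- the difference of the quotients is `s L(w) + s (R s / s²) → 0`
  have hD : Tendsto (fun s : ℝ => sectorAngFun μ ((θ₀, t₁, t₂), s) / s - sectorAngFun μ ((θ₀, 0, t₂), s) / s)
      (𝓝[≠] 0) (𝓝 0) := by
    have hs0 : Tendsto (fun s : ℝ => s) (𝓝[≠] (0 : ℝ)) (𝓝 0) := tendsto_id.mono_left nhdsWithin_le_nhds
    have h1 : Tendsto (fun s : ℝ => s * L w + s * ((T (u₁ s) - T (u₀ s) - L (u₁ s - u₀ s)) / s ^ 2)) (𝓝[≠] 0) (𝓝 0) := by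
      simpa using (hs0.mul_const (L w)).add (hs0.mul hRlim)
    refine h1.congr' ?_
    filter_upwards [self_mem_nhdsWithin] with s hs
    have hs' : s ≠ 0 := hs
    have hLd : L (u₁ s - u₀ s) = s ^ 2 * L w := by
      rw [hdiff, show ((s ^ 2 : ℝ) : ℂ) * w = (s ^ 2 : ℝ) • w from (Complex.real_smul).symm, map_smul, smul_eq_mul]
    rw [hLd, ← sub_div]
    have hval : sectorAngFun μ ((θ₀, t₁, t₂), s) - sectorAngFun μ ((θ₀, 0, t₂), s) = T (u₁ s) - T (u₀ s) := by
      simp only [sectorAngFun, hT, hu₁, hu₀]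
    rw [hval]
    field_simp
    ring
  have hD' : Tendsto (fun s : ℝ => sectorAngFun μ ((θ₀, t₁, t₂), s) / s - sectorAngFun μ ((θ₀, 0, t₂), s) / s)
      (𝓝[≠] 0) (𝓝 (rescaledAngle μ ((θ₀, t₁, t₂), 0) - rescaledAngle μ ((θ₀, 0, t₂), 0))) :=
    (tendsto_div_rescaledAngle hμ₁ hμ₂ _).sub (tendsto_div_rescaledAngle hμ₁ hμ₂ _)
  have := tendsto_nhds_unique hD' hD
  linarith

/-! ### The shear antisymmetry at `s = 0` -/

/-- The shift `δ(θ₀, t₂) = 2Ẽ(θ₀, 0, t₂; 0)/normalGrad(θ₀)`. [folklore] -/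
def zeroShift (μ θ₀ t₂ : ℝ) : ℝ := 2 * rescaledDispersion μ ((θ₀, 0, t₂), 0) / normalGrad μ θ₀

/-- The rescaled dispersion flips sign under the shear: `Ẽ(θ₀, -t₁ - δ, t₂; 0) = -Ẽ(θ₀, t₁, t₂; 0)`. [folklore] -/
theorem rescaledDispersion_zero_shear (θ₀ t₁ t₂ : ℝ) :
    rescaledDispersion μ ((θ₀, -t₁ - zeroShift μ θ₀ t₂, t₂), 0) = -rescaledDispersion μ ((θ₀, t₁, t₂), 0) := by
  have h1 := rescaledDispersion_zero_sub hμ₁ hμ₂ θ₀ (-t₁ - zeroShift μ θ₀ t₂) t₂ (μ := μ)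
  have h2 := rescaledDispersion_zero_sub hμ₁ hμ₂ θ₀ t₁ t₂ (μ := μ)
  have hg := (normalGrad_pos hμ₁ hμ₂ θ₀ (μ := μ)).ne'
  have h3 : normalGrad μ θ₀ * zeroShift μ θ₀ t₂ = 2 * rescaledDispersion μ ((θ₀, 0, t₂), 0) := by
    rw [zeroShift]; field_simp
  linear_combination h1 + h2 - h3

/-- **The shear antisymmetry of the master symbol at scale zero**:
`Φ̂(θ₀, (-t₀, -t₁ - δ(θ₀,t₂), t₂); 0) = -Φ̂(θ₀, (t₀, t₁, t₂); 0)` — the "oddity" of BGM (2.56e).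
[cite: BenfattoGiulianiMastropietro2006, §2.5 Lemma 2.2a (2.56e)] -/
theorem masterSymbol_zero_shear (e₀ θ₀ t₀ t₁ t₂ : ℝ) :
    masterSymbol μ e₀ (θ₀, -t₁ - zeroShift μ θ₀ t₂, t₂) (-t₀) 0 = -masterSymbol μ e₀ (θ₀, t₁, t₂) t₀ 0 := by
  have hE := rescaledDispersion_zero_shear hμ₁ hμ₂ θ₀ t₁ t₂ (μ := μ)
  have hA : rescaledAngle μ ((θ₀, -t₁ - zeroShift μ θ₀ t₂, t₂), 0) = rescaledAngle μ ((θ₀, t₁, t₂), 0) := by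
    rw [rescaledAngle_zero_eq hμ₁ hμ₂, rescaledAngle_zero_eq hμ₁ hμ₂ θ₀ t₁]
  have hu : sectorUFun μ (θ₀, -t₁ - zeroShift μ θ₀ t₂, t₂) 0 = sectorUFun μ (θ₀, t₁, t₂) 0 := by
    rw [sectorUFun_zero, sectorUFun_zero]
  have hk : sectorChartPoint μ (θ₀, -t₁ - zeroShift μ θ₀ t₂, t₂) 0 = sectorChartPoint μ (θ₀, t₁, t₂) 0 := by
    rw [sectorChartPoint_zero, sectorChartPoint_zero]
  have hD : rescaledDenom μ (θ₀, -t₁ - zeroShift μ θ₀ t₂, t₂) (-t₀) 0 = -rescaledDenom μ (θ₀, t₁, t₂) t₀ 0 := by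
    rw [rescaledDenom, rescaledDenom, hE]; push_cast; ring
  rw [masterSymbol, masterSymbol, hE, hA, hu, hk, hD, map_neg, Complex.normSq_neg, neg_sq, neg_sq]
  ring

end Zero

end Literature.MathematicalPhysics.QuantumLattice

end
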